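import Summits.BirchSwinnertonDyer.Rank1Residual.ManinAdditive.HermitianTwistTrichotomyAtThree
import Summits.BirchSwinnertonDyer.Rank1Residual.ManinAdditive.MinusOneTwistRigidity
import HarnessLib

/-!
# Proved edges for the analytic-lens leaves of cell `bsd-f2-manin` (E-an-5 / E-an-6 / E-an-8 (ii))

PROVED implications (no `sorry`, nothing new asserted):

* `modularDegree_eq_three_mul_of_trichotomy_of_smallDisc` : E-an-5 ∧ E-an-6 pin `deg′ = 3·deg` on the
  large-discriminant member of a commuting `−3`-twist pair (the planner's dictionary edge
  `deg_eq_three_mul_of_E6_E5`, HOME/an/Sketch-an2.lean 592a983c0c28c202);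
* `padicValInt_maninConstant_eq_of_minusOneTwistRigidity` : E-an-8 (ii) gives equal Manin valuations at
  every prime on a `−1`-twist pair with `2⁵ ∣ N` — the data form of «kills the `(2, χ₋₄)` instance of
  `RamifiedTwistManinInvariance`» (stated as the valuation equality; `c′ = ±c`).
-/

noncomputable section

open scoped MatrixGroups ModularForm

open CongruenceSubgroup WeierstrassCurve
  Literature.NumberTheory.EllipticCurves Literature.NumberTheory.EllipticCurves.ModularForms

namespace Summit.BirchSwinnertonDyer.Rank1Residual.ManinAdditive

/-- **E-an-5 ∧ E-an-6 ⟹ `deg′ = 3·deg` on the large-discriminant member of a commuting pair.** -/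
theorem modularDegree_eq_three_mul_of_trichotomy_of_smallDisc (h5 : HermitianTwistTrichotomyAtThree)
    (h6 : SmallDiscriminantCarriesSqrtMinusThree)
    (W W' : WeierstrassCurve ℚ) [W.IsElliptic] [W.IsGloballyMinimal] [W'.IsElliptic]
    [W'.IsGloballyMinimal] [NeZero (W.conductorNorm ℤ)] [NeZero (W'.conductorNorm ℤ)]
    (D : ModularParametrizationData W (W.conductorNorm ℤ))
    (D' : ModularParametrizationData W' (W'.conductorNorm ℤ)) (C : VariableChange ℚ)
    (hD : ∀ z ∈ D.L.lattice, ∃ w ∈ periodLattice D.f, z = D.c * w)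
    (hD' : ∀ z ∈ D'.L.lattice, ∃ w ∈ periodLattice D'.f, z = D'.c * w)
    (h27 : 3 ^ 3 ∣ W.conductorNorm ℤ) (hN : W'.conductorNorm ℤ = W.conductorNorm ℤ)
    (hC : C • W.quadraticTwist ((-3 : ℤ) : ℚ) = W')
    (htw : IsIsogenous (W.quadraticTwist ((-3 : ℤ) : ℚ)) W') (hne : ¬ IsIsogenous W W')
    (hΔ : padicValInt 3 W'.minimalDiscriminantInt = padicValInt 3 W.minimalDiscriminantInt + 6) :
    D'.modularDegree = 3 * D.modularDegree :=
  (h5 W W' D D' hD hD' h27 hN htw hne).2.1 (h6 W W' D D' C hD hD' h27 hN hC hΔ)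

/-- **E-an-8 (ii) ⟹ equal `p`-adic valuations of the Manin constants** of a `−1`-twist pair of optimal
curves with `2⁵ ∣ N` (every prime `p`; from `c′ = ±c`). -/
theorem padicValInt_maninConstant_eq_of_minusOneTwistRigidity (h : MinusOneTwistRigidity)
    (W W' : WeierstrassCurve ℚ) [W.IsElliptic] [W.IsGloballyMinimal] [W'.IsElliptic]
    [W'.IsGloballyMinimal] [NeZero (W.conductorNorm ℤ)] [NeZero (W'.conductorNorm ℤ)]
    (D : ModularParametrizationData W (W.conductorNorm ℤ))
    (D' : ModularParametrizationData W' (W'.conductorNorm ℤ))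
    (hD : ∀ z ∈ D.L.lattice, ∃ w ∈ periodLattice D.f, z = D.c * w)
    (hD' : ∀ z ∈ D'.L.lattice, ∃ w ∈ periodLattice D'.f, z = D'.c * w)
    (h32 : 2 ^ 5 ∣ W.conductorNorm ℤ) (hN : W'.conductorNorm ℤ = W.conductorNorm ℤ)
    (htw : IsIsogenous (W.quadraticTwist ((-1 : ℤ) : ℚ)) W') (hne : ¬ IsIsogenous W W') (p : ℕ) :
    padicValInt p D'.maninConstant = padicValInt p D.maninConstant := by
  rcases (h W W' D D' hD hD' h32 hN htw hne).2.2 with hc | hc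
  · simp only [ModularParametrizationData.maninConstant, hc]
  · simp only [ModularParametrizationData.maninConstant, hc, padicValInt, Int.natAbs_neg]

end Summit.BirchSwinnertonDyer.Rank1Residual.ManinAdditive

end
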